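import Summits.Ventures.WeilGRH.DualTrigKernelSoundC
import Summits.Ventures.WeilGRH.DualTrigRung
import HarnessLib

/-!
# Format D-K soundness, part 6: the terms of a certificate and the twisted prime ripple

Cell `rh-explicit`, WEIL TRACK — GRH ARM, route B (weil-grh-3).  Continuation of
`DualTrigKernelSoundC.lean`:

* the kernel-friendly arithmetic tests are correct (`coprimeB_iff`, `prime_of_isPrimeB`,
  `isPrimeB_of_prime`, `isPrimePowB_of_isPrimePow`);
* `atomTerm` / `valTerm` enclose explicit real terms (`atomR`, `valR`), so `terms` encloses the list
  `termsR` (`terms_repr`);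
* with `ω = log p₀ / D`: the atoms evaluate to `trigSum` of the `TrigAtom`s `⟨kω, a/2^cden, b/2^cden⟩`
  and the window terms to MINUS the twisted prime ripple `weilPrimeRippleChar χ N τ`, for every
  character `χ` mod `q` taking the claimed values (`sumVal_valsR_eq`).

Everything here is PROVED; no named facts, no `sorry`.
-/

noncomputable section

open Finset Real Complex

namespace Summit.Ventures.WeilGRH

open Literature.Analysis.ValidatedNumerics.NumericsMP
open Literature.NumberTheory.LFunctions
open DualTrigTaylor
open scoped ArithmeticFunction.vonMangoldt

namespace DKCert

variable {c : DKCert}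

/-! ### The arithmetic tests -/

/-- `gcdFuel` with enough fuel is `Nat.gcd`. [folklore] -/
theorem gcdFuel_eq : ∀ (f a b : ℕ), b < f → gcdFuel f a b = Nat.gcd a b
  | 0, _, _, h => absurd h (Nat.not_lt_zero _)
  | f + 1, a, 0, _ => by simp [gcdFuel]
  | f + 1, a, b + 1, h => by
      rw [gcdFuel, gcdFuel_eq f (b + 1) (a % (b + 1)) (lt_of_lt_of_le (Nat.mod_lt _ (by omega)) (by omega)),
        Nat.gcd_comm (b + 1), ← Nat.gcd_rec, Nat.gcd_comm]

/-- `coprimeB a b ↔ Nat.Coprime a b`. [folklore] -/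
theorem coprimeB_iff (a b : ℕ) : coprimeB a b = true ↔ Nat.Coprime a b := by
  unfold coprimeB
  rw [gcdFuel_eq _ _ _ (by omega), beq_iff_eq, Nat.Coprime]

/-- `noDivAux p d = true` means no `m ∈ [2, d]` divides `p`. [folklore] -/
theorem noDivAux_iff (p : ℕ) : ∀ d : ℕ, noDivAux p d = true ↔ ∀ m, 2 ≤ m → m ≤ d → ¬ m ∣ p
  | 0 => by simp only [noDivAux, true_iff]; intro m h1 h2; omega
  | d + 1 => by
      rw [noDivAux]
      by_cases hd : d + 1 < 2
      · rw [if_pos hd]; simp only [true_iff]; intro m h1 h2; omega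
      · rw [if_neg hd, Bool.and_eq_true, noDivAux_iff p d, bne_iff_ne, ne_eq]
        constructor
        · rintro ⟨h1, h2⟩ m hm1 hm2
          rcases Nat.lt_or_eq_of_le hm2 with hlt | rfl
          · exact h2 m hm1 (by omega)
          · intro hdvd; exact h1 (Nat.mod_eq_zero_of_dvd hdvd)
        · intro h
          refine ⟨fun h0 ↦ h (d + 1) (by omega) le_rfl (Nat.dvd_of_mod_eq_zero h0), fun m hm1 hm2 ↦
            h m hm1 (by omega)⟩

/-- `isPrimeB p = true → p` is prime. [folklore] -/
theorem prime_of_isPrimeB {p : ℕ} (h : isPrimeB p = true) : Nat.Prime p := by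
  unfold isPrimeB at h
  rw [Bool.and_eq_true, decide_eq_true_eq, noDivAux_iff] at h
  rw [Nat.prime_def_lt']
  exact ⟨h.1, fun m hm1 hm2 ↦ h.2 m hm1 (by omega)⟩

/-- A prime passes `isPrimeB`. [folklore] -/
theorem isPrimeB_of_prime {p : ℕ} (hp : Nat.Prime p) : isPrimeB p = true := by
  unfold isPrimeB
  rw [Bool.and_eq_true, decide_eq_true_eq, noDivAux_iff]
  rw [Nat.prime_def_lt'] at hp
  exact ⟨hp.1, fun m hm1 hm2 ↦ hp.2 m hm1 (by omega)⟩

/-- A prime power passes `isPrimePowB`. [folklore] -/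
theorem isPrimePowB_of_isPrimePow {n : ℕ} (h : IsPrimePow n) : isPrimePowB n = true := by
  rw [isPrimePow_nat_iff_bounded] at h
  obtain ⟨p, hp, k, hk, hprime, hk0, hpk⟩ := h
  unfold isPrimePowB
  rw [List.any_eq_true]
  refine ⟨p, List.mem_range.2 (by omega), ?_⟩
  rw [Bool.and_eq_true, List.any_eq_true]
  exact ⟨isPrimeB_of_prime hprime, k, List.mem_range.2 (by omega), by simp [hpk]; omega⟩

/-! ### The real terms of a certificate -/

/-- The frequency unit `ω = log p₀ / D`. [folklore] -/
def omegaR (c : DKCert) : ℝ := Real.log c.p0 / c.D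

/-- The real term of an atom (in the variable `θ = ωτ`). [folklore] -/
def atomR (c : DKCert) (atm : DKAtom) : RTerm :=
  ⟨atm.k, (atm.a : ℝ) / 2 ^ c.cden, (atm.b : ℝ) / 2 ^ c.cden⟩

/-- The atom as a `TrigAtom` in the variable `τ`: frequency `k ω`. [folklore] -/
def atomT (c : DKCert) (atm : DKAtom) : TrigAtom :=
  ⟨atm.k * c.omegaR, (atm.a : ℝ) / 2 ^ c.cden, (atm.b : ℝ) / 2 ^ c.cden⟩

/-- The claimed value `z = e^{2πi u/v}` of a window datum. [folklore] -/
def valZ (val : DKVal) : ℂ := Complex.exp (2 * π * ((val.u : ℝ) / val.v : ℝ) * I)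

/-- The real term of a window datum: frequency `D log n / log p₀`, coefficients
`−(2 log p/√n) Re z`, `−(2 log p/√n) Im z`. [folklore] -/
def valR (c : DKCert) (val : DKVal) : RTerm :=
  ⟨c.D * Real.log val.n / Real.log c.p0,
   -(2 * Real.log val.p * (Real.sqrt val.n)⁻¹ * (valZ val).re),
   -(2 * Real.log val.p * (Real.sqrt val.n)⁻¹ * (valZ val).im)⟩

/-- The real terms of a certificate, in the order of `terms`. [folklore] -/
def termsR (c : DKCert) : List RTerm := (c.atoms.map c.atomR) ++ (c.vals.map c.valR)

/-- `atomTerm` encloses `atomR`. [folklore] -/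
theorem atomTerm_repr (hS : 0 < c.S) (atm : DKAtom) : GRepr c.S c.R (c.atomTerm atm) (c.atomR atm) := by
  have hk : MI.mem c.S ((atm.k : ℝ)) (MI.ofInt c.S atm.k) := by exact_mod_cast MI.mem_ofInt c.S (atm.k : ℤ)
  have hp := (powList_spec hS hk (2 * c.R + 1)).2
  refine ⟨?_, ?_, hk, hp, fun _ ↦ rfl, fun _ m hm ↦ ?_⟩
  · have := MI.mem_ofFrac c.S atm.a (q := 2 ^ c.cden) (by positivity)
    simp only [atomTerm, atomR]; push_cast at this ⊢; exact this
  · have := MI.mem_ofFrac c.S atm.b (q := 2 ^ c.cden) (by positivity)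
    simp only [atomTerm, atomR]; push_cast at this ⊢; exact this
  · simp only [atomTerm, List.getD_eq_getElem?_getD, List.getElem?_map, List.getElem?_range (by omega : m < 2 * c.R + 2),
      Option.map_some, Option.getD_some]

/-- `logExact p0 n = some e` gives `p0 ^ e = n`. [folklore] -/
theorem pow_eq_of_logExact {p0 n e : ℕ} (h : logExact p0 n = some e) : p0 ^ e = n := by
  unfold logExact at h
  have := List.find?_some h
  simpa using this

/-- `valTerm` encloses `valR` (given `π ∈ piI`, `log p₀ ∈ logp0I` with positive lower end, and the
bracket checks of `valsOK` for this datum). [folklore] -/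
theorem valTerm_repr (hS : 0 < c.S) (hpi : MI.mem c.S Real.pi c.piI)
    (hlog : MI.mem c.S (Real.log c.p0) c.logp0I) (hp0 : 2 ≤ c.p0) (val : DKVal) (hv : 1 ≤ val.v)
    (hsden : 1 ≤ val.sden) (hn : 1 ≤ val.n) (hslo : val.slo ^ 2 * val.n ≤ val.sden ^ 2)
    (hshi : val.sden ^ 2 ≤ val.shi ^ 2 * val.n) {t : GTerm} (ht : c.valTerm val = some t) :
    GRepr c.S c.R t (c.valR val) := by
  unfold valTerm at ht
  cases hL : MI.logNat c.S c.Kser val.p with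
  | none => simp [hL] at ht
  | some L =>
  cases hX : c.chiBox val with
  | none => simp [hL, hX] at ht
  | some X =>
  cases hLn : MI.logNat c.S c.Kser val.n with
  | none => simp [hL, hX, hLn] at ht
  | some Ln =>
  simp only [hL, hX, hLn] at ht
  -- the common enclosures
  have hLm := MI.mem_logNat hS hL
  have hLnm := MI.mem_logNat hS hLn
  have hz : MC.mem c.S (valZ val) X := by
    unfold chiBox angleI at hX
    have harg : MI.mem c.S (2 * π * ((val.u : ℝ) / val.v)) ((c.piI.mulInt (2 * val.u)).divNat val.v) := by
      have := MI.mem_divNat (MI.mem_mulInt hpi (2 * val.u)) (n := val.v) (by omega)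
      convert this using 1; push_cast; ring
    have := MC.mem_expI hS hpi hX harg
    unfold valZ; exact_mod_cast this
  have hsq : MI.mem c.S ((Real.sqrt val.n)⁻¹)
      ⟨(MI.ofFrac c.S val.slo val.sden).lo, (MI.ofFrac c.S val.shi val.sden).hi⟩ := by
    have hnr : (0 : ℝ) < val.n := by exact_mod_cast hn
    have hsd : (0 : ℝ) < val.sden := by exact_mod_cast hsden
    have h1 : (val.slo : ℝ) / val.sden ≤ (Real.sqrt val.n)⁻¹ := by
      rw [div_le_iff₀ hsd, ← Real.sqrt_sq (by positivity : (0:ℝ) ≤ val.slo),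
        ← Real.sqrt_sq (by positivity : (0:ℝ) ≤ val.sden), ← Real.sqrt_inv, ← Real.sqrt_mul (by positivity)]
      apply Real.sqrt_le_sqrt
      rw [le_inv_mul_iff₀' hnr]
      exact_mod_cast hslo
    have h2 : (Real.sqrt val.n)⁻¹ ≤ (val.shi : ℝ) / val.sden := by
      rw [le_div_iff₀ hsd, ← Real.sqrt_sq (by positivity : (0:ℝ) ≤ val.shi),
        ← Real.sqrt_sq (by positivity : (0:ℝ) ≤ val.sden), ← Real.sqrt_inv, ← Real.sqrt_mul (by positivity)]
      apply Real.sqrt_le_sqrt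
      rw [inv_mul_le_iff₀' hnr]
      exact_mod_cast hshi
    have m1 := MI.mem_ofFrac c.S (val.slo : ℤ) (q := val.sden) (by omega)
    have m2 := MI.mem_ofFrac c.S (val.shi : ℤ) (q := val.sden) (by omega)
    push_cast at m1 m2
    exact MI.mem_span m1 m2 h1 h2
  set al : ℝ := 2 * Real.log val.p * (Real.sqrt val.n)⁻¹ with hal
  have halm : MI.mem c.S al ((MI.mul c.S L ⟨(MI.ofFrac c.S val.slo val.sden).lo,
      (MI.ofFrac c.S val.shi val.sden).hi⟩).mulInt 2) := by
    have := MI.mem_mulInt (MI.mem_mul hS hLm hsq) 2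
    rw [hal]; convert this using 1; push_cast; ring
  have hA : MI.mem c.S (c.valR val).A ((MI.mul c.S ((MI.mul c.S L ⟨(MI.ofFrac c.S val.slo val.sden).lo,
      (MI.ofFrac c.S val.shi val.sden).hi⟩).mulInt 2) X.re).neg) := by
    have := MI.mem_neg (MI.mem_mul hS halm hz.1)
    simp only [valR, hal] at this ⊢; exact this
  have hB : MI.mem c.S (c.valR val).B ((MI.mul c.S ((MI.mul c.S L ⟨(MI.ofFrac c.S val.slo val.sden).lo,
      (MI.ofFrac c.S val.shi val.sden).hi⟩).mulInt 2) X.im).neg) := by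
    have := MI.mem_neg (MI.mem_mul hS halm hz.2)
    simp only [valR, hal] at this ⊢; exact this
  have hp0r : (1 : ℝ) < c.p0 := by exact_mod_cast hp0
  have hlogp0 : 0 < Real.log c.p0 := Real.log_pos hp0r
  cases hE : logExact c.p0 val.n with
  | some e =>
    simp only [hE, Option.some.injEq] at ht
    subst ht
    have hpow := pow_eq_of_logExact hE
    have hκ : (c.valR val).κ = ((e * c.D : ℕ) : ℝ) := by
      simp only [valR]
      rw [← hpow]; push_cast
      rw [Real.log_pow]; field_simp
    have hk : MI.mem c.S (c.valR val).κ (MI.ofInt c.S (e * c.D : ℕ)) := by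
      rw [hκ]; exact_mod_cast MI.mem_ofInt c.S ((e * c.D : ℕ) : ℤ)
    refine ⟨hA, hB, hk, (powList_spec hS hk (2 * c.R + 1)).2, fun _ ↦ hκ, fun _ m hm ↦ ?_⟩
    simp only [List.getD_eq_getElem?_getD, List.getElem?_map, List.getElem?_range (by omega : m < 2 * c.R + 2),
      Option.map_some, Option.getD_some]
  | none =>
    simp only [hE] at ht
    cases hr : MI.divPos c.S (Ln.mulInt c.D) c.logp0I with
    | none => simp [hr] at ht
    | some r =>
      simp only [hr, Option.some.injEq] at ht
      subst ht
      have hk : MI.mem c.S (c.valR val).κ r := by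
        have := MI.mem_divPos hS hr (MI.mem_mulInt hLnm c.D) hlog
        simp only [valR]; convert this using 1; push_cast; ring
      exact ⟨hA, hB, hk, (powList_spec hS hk (2 * c.R + 1)).2, fun h ↦ by simp at h, fun h ↦ by simp at h⟩

/-- Unpacking `valsOK` for one datum. [folklore] -/
theorem valsOK_val (h : c.valsOK = true) {val : DKVal} (hv : val ∈ c.vals) :
    Nat.Prime val.p ∧ 1 ≤ val.e ∧ val.p ^ val.e = val.n ∧ val.n ≤ c.N ∧ Nat.Coprime val.n c.q ∧
      1 ≤ val.v ∧ 1 ≤ val.sden ∧ val.slo ^ 2 * val.n ≤ val.sden ^ 2 ∧ val.sden ^ 2 ≤ val.shi ^ 2 * val.n := by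
  unfold valsOK at h
  simp only [Bool.and_eq_true, List.all_eq_true, decide_eq_true_eq, beq_iff_eq] at h
  obtain ⟨⟨⟨_, hall⟩, _⟩, _⟩ := h
  obtain ⟨⟨⟨⟨⟨⟨⟨⟨hp, he⟩, hpe⟩, hN⟩, hco⟩, hvv⟩, hsd⟩, hslo⟩, hshi⟩ := hall val hv
  exact ⟨prime_of_isPrimeB hp, he, hpe, hN, (coprimeB_iff _ _).1 hco, hvv, hsd, hslo, hshi⟩

/-- **`terms` encloses `termsR`.** [folklore] -/
theorem terms_repr (hS : 0 < c.S) (hpi : MI.mem c.S Real.pi c.piI) (hlog : MI.mem c.S (Real.log c.p0) c.logp0I)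
    (hp0 : 2 ≤ c.p0) (hvals : c.valsOK = true) : List.Forall₂ (GRepr c.S c.R) c.terms c.termsR := by
  unfold terms termsR
  have hsome : c.valTerms.isSome = true := by
    unfold valsOK at hvals; simp only [Bool.and_eq_true] at hvals; exact hvals.1.1.1
  -- the atoms
  have hat : List.Forall₂ (GRepr c.S c.R) (c.atoms.map c.atomTerm) (c.atoms.map c.atomR) := by
    rw [List.forall₂_map_left_iff, List.forall₂_map_right_iff]
    exact List.forall₂_same.2 fun atm _ ↦ atomTerm_repr hS atm
  -- the vals
  have hvl : ∀ (vs : List DKVal), (∀ v ∈ vs, v ∈ c.vals) → ∀ {ts : List GTerm},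
      (vs.map c.valTerm).mapM id = some ts → List.Forall₂ (GRepr c.S c.R) ts (vs.map c.valR) := by
    intro vs
    induction vs with
    | nil => intro _ ts h; simp at h; subst h; exact List.Forall₂.nil
    | cons v vs ih =>
        intro hmem ts h
        rw [List.map_cons, List.mapM_cons] at h
        cases hv : c.valTerm v with
        | none => simp [hv] at h
        | some t =>
          simp only [hv, id, Option.pure_def, Option.bind_eq_bind, Option.bind_some] at h
          cases hrest : (vs.map c.valTerm).mapM id with
          | none => simp [hrest] at h
          | some ts' =>
            simp only [hrest, Option.bind_some, Option.some.injEq] at h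
            subst h
            obtain ⟨_, _, _, _, _, hvv, hsd, hslo, hshi⟩ := valsOK_val hvals (hmem v (by simp))
            have hn : 1 ≤ v.n := by
              obtain ⟨hp, he, hpe, -⟩ := valsOK_val hvals (hmem v (by simp))
              rw [← hpe]; exact Nat.one_le_pow _ _ hp.pos
            exact List.Forall₂.cons (valTerm_repr hS hpi hlog hp0 v hvv hsd hn hslo hshi hv)
              (ih (fun w hw ↦ hmem w (by simp [hw])) hrest)
  cases hvt : c.valTerms with
  | none => simp [hvt] at hsome
  | some ts =>
    simp only [Option.getD_some]
    exact List.rel_append hat (hvl c.vals (fun v hv ↦ hv) (by unfold valTerms at hvt; exact hvt))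

/-! ### Evaluating the real terms -/

/-- The atoms: `sumVal (atoms.map atomR) (ωτ) = trigSum (atoms.map atomT) τ`. [folklore] -/
theorem sumVal_atoms (τ : ℝ) : ∀ l : List DKAtom,
    sumVal (l.map c.atomR) (c.omegaR * τ) = trigSum (l.map c.atomT) τ
  | [] => by simp
  | atm :: l => by
      rw [List.map_cons, List.map_cons, sumVal_cons, trigSum_cons, sumVal_atoms τ l]
      simp only [RTerm.val, atomR, TrigAtom.eval, atomT]
      ring_nf

variable {χ : DirichletCharacter ℂ c.q}

/-- One window term evaluates to minus the corresponding summand of the ripple. [folklore] -/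
theorem valR_val (hp0 : 2 ≤ c.p0) (hD : 1 ≤ c.D) {val : DKVal} (hp : Nat.Prime val.p) (he : 1 ≤ val.e)
    (hpe : val.p ^ val.e = val.n) (hχ : χ (val.n : ZMod c.q) = valZ val) (τ : ℝ) :
    (c.valR val).val (c.omegaR * τ) =
      -((Λ val.n : ℝ) / Real.sqrt val.n * (2 * ((χ (val.n : ZMod c.q)).re * Real.cos (τ * Real.log val.n) +
        (χ (val.n : ZMod c.q)).im * Real.sin (τ * Real.log val.n)))) := by
  have hp0r : (1 : ℝ) < c.p0 := by exact_mod_cast hp0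
  have hlogp0 : Real.log c.p0 ≠ 0 := (Real.log_pos hp0r).ne'
  have hDr : (c.D : ℝ) ≠ 0 := by exact_mod_cast (show c.D ≠ 0 by omega)
  have hΛ : (Λ val.n : ℝ) = Real.log val.p := by
    rw [← hpe, ArithmeticFunction.vonMangoldt_apply_pow (by omega), ArithmeticFunction.vonMangoldt_apply_prime hp]
  have hfreq : (c.valR val).κ * (c.omegaR * τ) = τ * Real.log val.n := by
    simp only [valR, omegaR]; field_simp
  rw [hχ, RTerm.val, hfreq, hΛ]
  simp only [valR, div_eq_mul_inv]
  ring

/-- The summand of the ripple at `n`. [folklore] -/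
def rippleTerm (χ : DirichletCharacter ℂ c.q) (τ : ℝ) (n : ℕ) : ℝ :=
  (Λ n : ℝ) / Real.sqrt n * (2 * ((χ (n : ZMod c.q)).re * Real.cos (τ * Real.log n) +
    (χ (n : ZMod c.q)).im * Real.sin (τ * Real.log n)))

/-- The ripple summand vanishes unless `n` is a prime power coprime to `q`. [folklore] -/
theorem rippleTerm_eq_zero {τ : ℝ} {n : ℕ} (h : ¬ (IsPrimePow n ∧ Nat.Coprime n c.q)) :
    rippleTerm χ τ n = 0 := by
  unfold rippleTerm
  by_cases hpp : IsPrimePow n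
  · have hco : ¬ Nat.Coprime n c.q := fun hc ↦ h ⟨hpp, hc⟩
    have hz : χ (n : ZMod c.q) = 0 :=
      MulChar.map_nonunit χ (mt (ZMod.isUnit_iff_coprime n c.q).1 hco)
    simp [hz]
  · rw [ArithmeticFunction.vonMangoldt_eq_zero_iff.2 hpp]; simp

/-- **The window terms evaluate to minus the twisted prime ripple**: for `χ` taking the claimed
values, `sumVal (vals.map valR) (ωτ) = −weilPrimeRippleChar χ N τ`. [folklore] -/
theorem sumVal_valsR_eq (hp0 : 2 ≤ c.p0) (hD : 1 ≤ c.D) (hvals : c.valsOK = true)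
    (hnodup : (c.vals.map (·.n)).Nodup)
    (hχ : ∀ val ∈ c.vals, χ (val.n : ZMod c.q) = valZ val) (τ : ℝ) :
    sumVal (c.vals.map c.valR) (c.omegaR * τ) = -weilPrimeRippleChar χ c.N τ := by
  -- both sides as sums of `rippleTerm` over the listed `n`
  have h1 : sumVal (c.vals.map c.valR) (c.omegaR * τ) = -((c.vals.map (·.n)).map (rippleTerm χ τ)).sum := by
    have : ∀ vs : List DKVal, (∀ v ∈ vs, v ∈ c.vals) →
        sumVal (vs.map c.valR) (c.omegaR * τ) = -((vs.map (·.n)).map (rippleTerm χ τ)).sum := by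
      intro vs
      induction vs with
      | nil => simp
      | cons v vs ih =>
          intro hmem
          obtain ⟨hp, he, hpe, -⟩ := valsOK_val hvals (hmem v (by simp))
          rw [List.map_cons, sumVal_cons, ih (fun w hw ↦ hmem w (by simp [hw])),
            valR_val hp0 hD hp he hpe (hχ v (hmem v (by simp))) τ]
          simp [rippleTerm]; ring
    exact this c.vals fun v hv ↦ hv
  rw [h1]
  unfold weilPrimeRippleChar
  rw [show (∑ n ∈ range (c.N + 1), (Λ n : ℝ) / Real.sqrt n * (2 * ((χ (n : ZMod c.q)).re *
      Real.cos (τ * Real.log n) + (χ (n : ZMod c.q)).im * Real.sin (τ * Real.log n)))) =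
      ∑ n ∈ range (c.N + 1), rippleTerm χ τ n from rfl]
  rw [← List.sum_toFinset _ hnodup]
  congr 1
  apply Finset.sum_subset
  · intro n hn
    rw [List.mem_toFinset, List.mem_map] at hn
    obtain ⟨v, hv, rfl⟩ := hn
    exact Finset.mem_range.2 (by have := (valsOK_val hvals hv).2.2.2.1; omega)
  · intro n hn hnot
    apply rippleTerm_eq_zero
    intro ⟨hpp, hco⟩
    -- coverage check of `valsOK`: a coprime prime power `n ≤ N` is listed
    have hvals' := hvals
    unfold valsOK at hvals'
    simp only [Bool.and_eq_true] at hvals'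
    obtain ⟨⟨⟨_, _⟩, hcov⟩, _⟩ := hvals'
    rw [List.all_eq_true] at hcov
    have hc' := hcov n (List.mem_range.2 (Finset.mem_range.1 hn))
    rw [Bool.or_eq_true, Bool.or_eq_true] at hc'
    rcases hc' with (h1 | h2) | h3
    · rw [List.any_eq_true] at h1
      obtain ⟨v, hv, hvn⟩ := h1
      rw [beq_iff_eq] at hvn
      exact hnot (List.mem_toFinset.2 (List.mem_map.2 ⟨v, hv, hvn⟩))
    · have hc2 : coprimeB n c.q = true := (coprimeB_iff n c.q).2 hco
      rw [hc2] at h2; exact absurd h2 (by decide)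
    · have hc3 : isPrimePowB n = true := isPrimePowB_of_isPrimePow hpp
      rw [hc3] at h3; exact absurd h3 (by decide)

end DKCert

end Summit.Ventures.WeilGRH

end
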